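import Literature.Computability.Cryptography.GraphPathProblemsBounds
import Literature.Computability.Cryptography.FGProblemZoo
import HarnessLib

/-!
# Distance product `≤₃` Negative Triangle (VW–W 2018, Thm. 4.2): the query gadget

The pure mathematics behind the verified product step `psNT`
(`Literature.Computability.FineGrained.MinPlusToNegativeTriangleProgram`) of the reduction
APSP `≤₃` Negative Triangle (Vassilevska Williams–Williams, J. ACM 65 (2018), Thm. 1.1,
direction (1) `≤₃` (3), in print APSP `≤₃` distance product `≤₃` Negative Triangle, Thm. 4.2).
The step computes the codes of a distance product `X ⋆ Y` of `n × n` matrices with entries in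
`[-M, M] ∪ {∞}` from an oracle deciding Negative Triangle, by the simultaneous binary search of
the proof of Thm. 4.2 (pp. 27:17–18) driven by the edge-deleting search of the proof of Lemma 4.2
(pp. 27:16–17) on triples of blocks.

* `QData`, `QData.qmat`: the query graph of a block triple `(bi, bj, bk)` with blocks of side `L`:
  `3L` vertices — rows, middles, columns — with arcs rows → middles weighted by `X`, middles →
  columns by `Y` (VW–W p. 27:17: "`w(i, k) = A[i, k]`, `w(k, j) = B[k, j]`") and columns → rows by
  the negated threshold `2M - (lo + pw)` of a pair still searched for ("`w(i, j) = -(S[i, j] +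
  H[i, j])/2`"; here in the dyadic form lower bound `lo` plus current bit `pw`, values shifted by
  `2M` to be nonnegative); every other arc, and the back arc of a pair out of range, outside the
  current windows or already found in this round (the deleted edges of Lemma 4.2), carries the
  non-edge weight `big M = 16M + 4` — the zoo's `NegativeTriangle` is about complete digraphs, so
  tripartiteness is enforced by weights;
* `QData.hasNegativeTriangle_qmat_iff`: the negative triangles of the query graph are exactly the
  witnesses (`QData.Witness`): an active pair `(i, j)` and a middle vertex `k` of the block with
  `X i k + Y k j + 2M < lo + pw` (a triangle through a non-edge weighs at least
  `big M - 2 (6M + 2) ≥ 0`); `QData.hasBoundedWeights_qmat`: its weights are `big M`-bounded;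
* `lo_step`, `lo_start`, `lo_add_pw_lt`: one round of the binary search in dyadic form — if `lo`
  is the value rounded down to a multiple of `2 pw`, then `lo + [value ≥ lo + pw] · pw` is the value
  rounded down to a multiple of `pw`;
* `tval`, `tval_lt_iff`, `tval_lt`, `encode_of_tval`: the searched value of a pair,
  `(X ⋆ Y)ᵢⱼ + 2M ∈ [0, 4M]` for a finite entry and `P - 1` for `⊤` (`P` the top power of two,
  `4M + 2 ≤ P`), and the decoding of the code of `(X ⋆ Y)ᵢⱼ` from it;
* windows and pair witnesses (`QData.PairWit`, `QData.witness_row_iff`, `QData.witness_cell_iff`):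
  restricting the back arcs to a window of rows and columns locates a witness pair by detection
  queries on single rows and single cells (used in place of the recursive halving of VW–W
  Lemma 4.1); `tval_lt_of_pairWit`, `pairWit_of_tval_lt`, `found_of_tval_lt`: a pair has a witness
  in some middle block iff it is unfound and its value lies below its threshold — the soundness
  and completeness of a round (VW–W p. 27:17, "Notice that the invariant is still satisfied …").

## References

* V. Vassilevska Williams, R. R. Williams, *Subcubic equivalences between path, matrix, and
  triangle problems*, J. ACM 65 (2018), Art. 27: Thm. 4.2 (p. 27:14; proof pp. 27:17–18),
  Lemma 4.1 (pp. 27:14–15), Lemma 4.2 (p. 27:16; proof pp. 27:16–17). doi:10.1145/3186893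
-/

namespace Literature.Computability.FineGrained.NegTriStep

open Cryptography Matrix

/-! ## The tripartite query graph -/

/-- The weight of a non-edge: larger than twice the absolute value of every genuine arc. [folklore] -/
def big (M : ℕ) : ℕ := 16 * M + 4

/-- The data of one query of the product step: operands, the current lower bounds and found
stamps (arrays over the `n²` global pairs, row-major), the bound `M`, the current bit `pw`, the
block triple and the row/column windows (local indices). [folklore] -/
structure QData (n : ℕ) where
  /-- First operand. -/
  X : Matrix (Fin n) (Fin n) (WithTop ℤ)
  /-- Second operand. -/
  Y : Matrix (Fin n) (Fin n) (WithTop ℤ)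
  /-- Lower bounds of the pairs, row-major. -/
  lo : ℕ → ℕ
  /-- Found stamps of the pairs, row-major. -/
  fd : ℕ → ℕ
  /-- The entry bound `M` (offset `2M`). -/
  M : ℕ
  /-- The current bit. -/
  pw : ℕ
  /-- Block side. -/
  L : ℕ
  /-- Row block. -/
  bi : ℕ
  /-- Column block. -/
  bj : ℕ
  /-- Middle block. -/
  bk : ℕ
  /-- Row window `[rlo, rhi)` (local row indices). -/
  rlo : ℕ
  /-- Row window upper end. -/
  rhi : ℕ
  /-- Column window `[clo, chi)`. -/
  clo : ℕ
  /-- Column window upper end. -/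
  chi : ℕ

namespace QData

variable {n : ℕ} (q : QData n)

/-- A finite entry of a `WithTop ℤ` matrix at global indices, `big` otherwise (out of range or `⊤`). [folklore] -/
def entryOr (Z : Matrix (Fin n) (Fin n) (WithTop ℤ)) (M a b : ℕ) : ℤ :=
  if h : a < n ∧ b < n then
    match Z ⟨a, h.1⟩ ⟨b, h.2⟩ with
    | ⊤ => big M
    | (z : ℤ) => z
  else big M

/-- The arc from row vertex `iu` (global row `bi L + iu`) to middle vertex `iv`. [folklore] -/
def xarc (iu iv : ℕ) : ℤ := entryOr q.X q.M (q.bi * q.L + iu) (q.bk * q.L + iv)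

/-- The arc from middle vertex `iu` to column vertex `iv`. [folklore] -/
def yarc (iu iv : ℕ) : ℤ := entryOr q.Y q.M (q.bk * q.L + iu) (q.bj * q.L + iv)

/-- The pair `(row iv, column iu)` takes part in the query: in range, inside the windows, not yet
found in this round. [folklore] -/
def Active (iu iv : ℕ) : Prop :=
  q.bi * q.L + iv < n ∧ q.bj * q.L + iu < n ∧ q.rlo ≤ iv ∧ iv < q.rhi ∧ q.clo ≤ iu ∧ iu < q.chi ∧
    q.fd ((q.bi * q.L + iv) * n + (q.bj * q.L + iu)) ≠ q.pw

/-- Activity of a pair is decidable. [folklore] -/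
instance (iu iv : ℕ) : Decidable (q.Active iu iv) := by unfold Active; infer_instance

/-- The arc from column vertex `iu` (global column `bj L + iu`) back to row vertex `iv` (global row
`bi L + iv`): the negated threshold `2M - (lo + pw)` of the pair if it is active, a non-edge
otherwise. [folklore] -/
def tarc (iu iv : ℕ) : ℤ :=
  if q.Active iu iv then (2 * q.M : ℤ) - (q.lo ((q.bi * q.L + iv) * n + (q.bj * q.L + iu)) + q.pw)
  else big q.M

/-- **The query graph** on vertex numbers: `3L` vertices in three parts (rows, middles, columns,
by `u / L`), arcs rows → middles weighted by `X`, middles → columns by `Y`, columns → rows by the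
negated thresholds of the active pairs; every other arc is a non-edge of weight `big M`. [folklore] -/
def qmatN (u v : ℕ) : ℤ :=
  if u / q.L = 0 ∧ v / q.L = 1 then q.xarc (u % q.L) (v % q.L)
  else if u / q.L = 1 ∧ v / q.L = 2 then q.yarc (u % q.L) (v % q.L)
  else if u / q.L = 2 ∧ v / q.L = 0 then q.tarc (u % q.L) (v % q.L)
  else big q.M

/-- The query graph as a matrix on `Fin (3L)`. [folklore] -/
def qmat : Matrix (Fin (3 * q.L)) (Fin (3 * q.L)) ℤ := fun u v => q.qmatN u v

/-- **The witness predicate of a query `q`** (a PREDICATE on the query data, decided by the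
oracle — not a closed statement: it fails e.g. for the empty query `L = 0`,
`QData.not_witness_of_L_eq_zero`, and holds for others): there are a local row `iv`, column `iu`
and middle `kk` with the pair `(iv, iu)` active, both arcs finite, and `X + Y + 2M < lo + pw`.
The query `q` is an explicit binder (not the section variable) so that the declaration reads as
the parametrised predicate it is. [folklore] -/
def Witness (q : QData n) : Prop :=
  ∃ (iu iv kk : ℕ) (_ : iu < q.L) (_ : iv < q.L) (_ : kk < q.L) (ha : q.Active iu iv)
    (hk : q.bk * q.L + kk < n) (x y : ℤ),
      q.X ⟨q.bi * q.L + iv, ha.1⟩ ⟨q.bk * q.L + kk, hk⟩ = x ∧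
      q.Y ⟨q.bk * q.L + kk, hk⟩ ⟨q.bj * q.L + iu, ha.2.1⟩ = y ∧
      x + y + 2 * q.M < q.lo ((q.bi * q.L + iv) * n + (q.bj * q.L + iu)) + q.pw

/-- The empty query (block side `L = 0`) has no witness; in particular `Witness` is not true of
every query. [folklore] -/
theorem not_witness_of_L_eq_zero (h : q.L = 0) : ¬ q.Witness := by
  rintro ⟨iu, iv, kk, hiu, -⟩
  omega

/-! ### The arcs: a non-edge, or a genuine bounded weight -/

/-- The non-edge weight is nonnegative. [folklore] -/
theorem big_nonneg (M : ℕ) : (0 : ℤ) ≤ big M := by unfold big; positivity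

/-- `entryOr` is the non-edge weight, or the indices are in range and it is the finite, `M`-bounded entry. [folklore] -/
theorem entryOr_cases {Z : Matrix (Fin n) (Fin n) (WithTop ℤ)} {M : ℕ} (hZ : HasBoundedWeights Z M)
    (a b : ℕ) : entryOr Z M a b = big M ∨ ∃ (h : a < n ∧ b < n) (z : ℤ),
      Z ⟨a, h.1⟩ ⟨b, h.2⟩ = z ∧ entryOr Z M a b = z ∧ |z| ≤ M := by
  unfold entryOr
  by_cases h : a < n ∧ b < n
  · rw [dif_pos h]
    rcases hZ ⟨a, h.1⟩ ⟨b, h.2⟩ with htop | ⟨z, hz, hzM⟩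
    · left; rw [htop]
    · right; exact ⟨h, z, hz, by rw [hz], hzM⟩
  · left; rw [dif_neg h]

/-- If `entryOr` is not the non-edge then the indices are in range and the entry is that finite
weight. [folklore] -/
theorem entryOr_ne_big {Z : Matrix (Fin n) (Fin n) (WithTop ℤ)} {M : ℕ} (hZ : HasBoundedWeights Z M)
    {a b : ℕ} (hne : entryOr Z M a b ≠ big M) :
    ∃ (h : a < n ∧ b < n) (z : ℤ), Z ⟨a, h.1⟩ ⟨b, h.2⟩ = z ∧ entryOr Z M a b = z ∧ |z| ≤ M := by
  rcases entryOr_cases hZ a b with h | h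
  · exact absurd h hne
  · exact h

/-- `entryOr` is at least `-M`. [folklore] -/
theorem entryOr_ge {Z : Matrix (Fin n) (Fin n) (WithTop ℤ)} {M : ℕ} (hZ : HasBoundedWeights Z M)
    (a b : ℕ) : -(M : ℤ) ≤ entryOr Z M a b := by
  rcases entryOr_cases hZ a b with h | ⟨_, z, _, h, hzM⟩
  · rw [h]; linarith [big_nonneg M]
  · rw [h]; exact (abs_le.1 hzM).1

/-- A back arc is the non-edge weight, or the pair is active and it is the negated threshold. [folklore] -/
theorem tarc_cases (iu iv : ℕ) : q.tarc iu iv = big q.M ∨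
    (q.Active iu iv ∧ q.tarc iu iv =
      (2 * q.M : ℤ) - (q.lo ((q.bi * q.L + iv) * n + (q.bj * q.L + iu)) + q.pw)) := by
  unfold tarc
  by_cases h : q.Active iu iv
  · right; exact ⟨h, by rw [if_pos h]⟩
  · left; rw [if_neg h]

/-- Back arcs are at least `-(6M + 2)` when the thresholds are at most `8M + 2`. [folklore] -/
theorem tarc_ge (hlo : ∀ t, t < n * n → q.lo t + q.pw ≤ 8 * q.M + 2) (iu iv : ℕ) :
    -(6 * q.M + 2 : ℤ) ≤ q.tarc iu iv := by
  rcases q.tarc_cases iu iv with h | ⟨hact, h⟩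
  · rw [h]; linarith [big_nonneg q.M]
  · rw [h]
    have hidx : (q.bi * q.L + iv) * n + (q.bj * q.L + iu) < n * n := by
      have h1 := hact.1; have h2 := hact.2.1
      calc (q.bi * q.L + iv) * n + (q.bj * q.L + iu) < (q.bi * q.L + iv) * n + n := by omega
        _ = (q.bi * q.L + iv + 1) * n := by ring
        _ ≤ n * n := Nat.mul_le_mul_right _ h1
    have := hlo ((q.bi * q.L + iv) * n + (q.bj * q.L + iu)) hidx
    have : ((q.lo ((q.bi * q.L + iv) * n + (q.bj * q.L + iu)) + q.pw : ℕ) : ℤ) ≤ 8 * q.M + 2 := by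
      exact_mod_cast this
    push_cast at this
    linarith

/-- Every arc of the query graph is at least `-(6M + 2)`. [folklore] -/
theorem qmat_ge (hX : HasBoundedWeights q.X q.M) (hY : HasBoundedWeights q.Y q.M)
    (hlo : ∀ t, t < n * n → q.lo t + q.pw ≤ 8 * q.M + 2) (u v : Fin (3 * q.L)) :
    -(6 * q.M + 2 : ℤ) ≤ q.qmat u v := by
  unfold qmat qmatN
  have hM : (0 : ℤ) ≤ q.M := Nat.cast_nonneg _
  split_ifs
  · exact le_trans (by linarith) (entryOr_ge hX _ _)
  · exact le_trans (by linarith) (entryOr_ge hY _ _)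
  · exact q.tarc_ge hlo _ _
  · linarith [big_nonneg q.M]

/-! ### Negative triangles of the query graph are exactly the witnesses -/

/-- A triangle through the three parts in the order rows → middles → columns with negative weight
is a witness. [folklore] -/
theorem witness_of_parts (hX : HasBoundedWeights q.X q.M) (hY : HasBoundedWeights q.Y q.M)
    (hlo : ∀ t, t < n * n → q.lo t + q.pw ≤ 8 * q.M + 2) (hL : 0 < q.L) {a b c : Fin (3 * q.L)}
    (ha : (a : ℕ) / q.L = 0) (hb : (b : ℕ) / q.L = 1) (hc : (c : ℕ) / q.L = 2)
    (hneg : q.qmat a b + q.qmat b c + q.qmat c a < 0) : q.Witness := by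
  have hM : (0 : ℤ) ≤ q.M := Nat.cast_nonneg _
  have hab : q.qmat a b = q.xarc (a % q.L) (b % q.L) := by
    unfold qmat qmatN; rw [if_pos ⟨ha, hb⟩]
  have hbc : q.qmat b c = q.yarc (b % q.L) (c % q.L) := by
    unfold qmat qmatN; rw [if_neg (by omega), if_pos ⟨hb, hc⟩]
  have hca : q.qmat c a = q.tarc (c % q.L) (a % q.L) := by
    unfold qmat qmatN; rw [if_neg (by omega), if_neg (by omega), if_pos ⟨hc, ha⟩]
  rw [hab, hbc, hca] at hneg
  -- none of the three arcs is a non-edge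
  have hge1 := entryOr_ge hX (q.bi * q.L + a % q.L) (q.bk * q.L + b % q.L)
  have hge2 := entryOr_ge hY (q.bk * q.L + b % q.L) (q.bj * q.L + c % q.L)
  have hge3 := q.tarc_ge hlo (c % q.L) (a % q.L)
  change -(q.M : ℤ) ≤ q.xarc (a % q.L) (b % q.L) at hge1
  change -(q.M : ℤ) ≤ q.yarc (b % q.L) (c % q.L) at hge2
  have hbig : (big q.M : ℤ) = 16 * q.M + 4 := by unfold big; push_cast; ring
  have hx : q.xarc (a % q.L) (b % q.L) ≠ big q.M := fun h => by rw [h] at hneg; linarith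
  have hy : q.yarc (b % q.L) (c % q.L) ≠ big q.M := fun h => by rw [h] at hneg; linarith
  have ht : q.tarc (c % q.L) (a % q.L) ≠ big q.M := fun h => by rw [h] at hneg; linarith
  obtain ⟨hrx, x, hXx, hxe, -⟩ := entryOr_ne_big hX hx
  obtain ⟨hry, y, hYy, hye, -⟩ := entryOr_ne_big hY hy
  rcases q.tarc_cases (c % q.L) (a % q.L) with h | ⟨hact, hte⟩
  · exact absurd h ht
  change q.xarc (a % q.L) (b % q.L) = x at hxe
  change q.yarc (b % q.L) (c % q.L) = y at hye
  rw [hxe, hye, hte] at hneg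
  refine ⟨c % q.L, a % q.L, b % q.L, Nat.mod_lt _ hL, Nat.mod_lt _ hL, Nat.mod_lt _ hL, hact,
    hrx.2, x, y, hXx, hYy, ?_⟩
  have : (x + y + 2 * q.M : ℤ) < (q.lo ((q.bi * q.L + a % q.L) * n + (q.bj * q.L + c % q.L)) + q.pw : ℕ) := by
    push_cast; linarith
  exact_mod_cast this

/-- **The negative triangles of the query graph are exactly the witnesses** (entries of `X, Y`
bounded by `M`, thresholds at most `8M + 2`, so that a triangle through a non-edge weighs at
least `big M - 2 (6M + 2) = 4M ≥ 0`). [folklore] -/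
theorem hasNegativeTriangle_qmat_iff (hX : HasBoundedWeights q.X q.M)
    (hY : HasBoundedWeights q.Y q.M) (hlo : ∀ t, t < n * n → q.lo t + q.pw ≤ 8 * q.M + 2) (hL : 0 < q.L) :
    HasNegativeTriangle q.qmat ↔ q.Witness := by
  have hM : (0 : ℤ) ≤ q.M := Nat.cast_nonneg _
  have hbig : (big q.M : ℤ) = 16 * q.M + 4 := by unfold big; push_cast; ring
  constructor
  · rintro ⟨a, b, c, hab, hbc, hac, hneg⟩
    -- no arc of a negative triangle is a non-edge
    have hge := q.qmat_ge hX hY hlo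
    have hne : ∀ u v w : Fin (3 * q.L), q.qmat u v + q.qmat v w + q.qmat w u < 0 →
        q.qmat u v ≠ big q.M := by
      intro u v w h huv
      have := hge v w; have := hge w u
      rw [huv] at h; linarith
    have hrot1 : q.qmat b c + q.qmat c a + q.qmat a b < 0 := by linarith
    have hrot2 : q.qmat c a + q.qmat a b + q.qmat b c < 0 := by linarith
    have h1 := hne a b c hneg
    have h2 := hne b c a hrot1
    have h3 := hne c a b hrot2
    -- the parts of a genuine arc
    have hparts : ∀ u v : Fin (3 * q.L), q.qmat u v ≠ big q.M →
        ((u : ℕ) / q.L = 0 ∧ (v : ℕ) / q.L = 1) ∨ ((u : ℕ) / q.L = 1 ∧ (v : ℕ) / q.L = 2) ∨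
        ((u : ℕ) / q.L = 2 ∧ (v : ℕ) / q.L = 0) := by
      intro u v h
      unfold qmat qmatN at h
      split_ifs at h with h01 h12 h20
      · exact Or.inl h01
      · exact Or.inr (Or.inl h12)
      · exact Or.inr (Or.inr h20)
      · exact absurd rfl h
    rcases hparts a b h1 with ⟨ha, hb⟩ | ⟨ha, hb⟩ | ⟨ha, hb⟩
    · rcases hparts b c h2 with ⟨hb', hc⟩ | ⟨hb', hc⟩ | ⟨hb', hc⟩ <;> try omega
      exact q.witness_of_parts hX hY hlo hL ha hb hc hneg
    · rcases hparts b c h2 with ⟨hb', hc⟩ | ⟨hb', hc⟩ | ⟨hb', hc⟩ <;> try omega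
      exact q.witness_of_parts hX hY hlo hL hc ha hb hrot2
    · rcases hparts b c h2 with ⟨hb', hc⟩ | ⟨hb', hc⟩ | ⟨hb', hc⟩ <;> try omega
      exact q.witness_of_parts hX hY hlo hL hb hc ha hrot1
  · rintro ⟨iu, iv, kk, hiu, hiv, hkk, hact, hk, x, y, hXx, hYy, hlt⟩
    have h3L : q.L ≤ 3 * q.L := by omega
    refine ⟨⟨iv, by omega⟩, ⟨q.L + kk, by omega⟩, ⟨2 * q.L + iu, by omega⟩, ?_, ?_, ?_, ?_⟩
    · simp only [ne_eq, Fin.mk.injEq]; omega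
    · simp only [ne_eq, Fin.mk.injEq]; omega
    · simp only [ne_eq, Fin.mk.injEq]; omega
    have ha : iv / q.L = 0 := Nat.div_eq_of_lt hiv
    have hb : (q.L + kk) / q.L = 1 := by
      rw [Nat.add_comm, Nat.add_div_right _ hL, Nat.div_eq_of_lt hkk]
    have hc : (2 * q.L + iu) / q.L = 2 := by
      rw [Nat.add_comm, Nat.add_mul_div_right _ _ hL, Nat.div_eq_of_lt hiu]
    have hma : iv % q.L = iv := Nat.mod_eq_of_lt hiv
    have hmb : (q.L + kk) % q.L = kk := by rw [Nat.add_comm, Nat.add_mod_right, Nat.mod_eq_of_lt hkk]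
    have hmc : (2 * q.L + iu) % q.L = iu := by
      rw [Nat.add_comm, Nat.add_mul_mod_self_right, Nat.mod_eq_of_lt hiu]
    have hab : q.qmat ⟨iv, by omega⟩ ⟨q.L + kk, by omega⟩ = x := by
      unfold qmat qmatN; simp only []; rw [if_pos ⟨ha, hb⟩, hma, hmb]
      unfold xarc entryOr; rw [dif_pos ⟨hact.1, hk⟩]; simp only [hXx]
    have hbc : q.qmat ⟨q.L + kk, by omega⟩ ⟨2 * q.L + iu, by omega⟩ = y := by
      unfold qmat qmatN; simp only []; rw [if_neg (by omega), if_pos ⟨hb, hc⟩, hmb, hmc]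
      unfold yarc entryOr; rw [dif_pos ⟨hk, hact.2.1⟩]; simp only [hYy]
    have hca : q.qmat ⟨2 * q.L + iu, by omega⟩ ⟨iv, by omega⟩ =
        (2 * q.M : ℤ) - (q.lo ((q.bi * q.L + iv) * n + (q.bj * q.L + iu)) + q.pw) := by
      unfold qmat qmatN; simp only []; rw [if_neg (by omega), if_neg (by omega), if_pos ⟨hc, ha⟩, hmc, hma]
      unfold tarc; rw [if_pos hact]
    rw [hab, hbc, hca]
    have : (x + y + 2 * q.M : ℤ) < (q.lo ((q.bi * q.L + iv) * n + (q.bj * q.L + iu)) + q.pw : ℕ) := by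
      exact_mod_cast hlt
    push_cast at this
    linarith

/-! ### The query is a Negative-Triangle instance -/

/-- The entries of the query graph are bounded by the non-edge weight. [folklore] -/
theorem abs_qmat_le (hX : HasBoundedWeights q.X q.M) (hY : HasBoundedWeights q.Y q.M)
    (hlo : ∀ t, t < n * n → q.lo t + q.pw ≤ 8 * q.M + 2) (u v : Fin (3 * q.L)) :
    |q.qmat u v| ≤ big q.M := by
  have hM : (0 : ℤ) ≤ q.M := Nat.cast_nonneg _
  have hbig : (big q.M : ℤ) = 16 * q.M + 4 := by unfold big; push_cast; ring
  rw [abs_le]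
  refine ⟨le_trans (by linarith) (q.qmat_ge hX hY hlo u v), ?_⟩
  unfold qmat qmatN
  split_ifs
  · change entryOr _ _ _ _ ≤ _
    rcases entryOr_cases hX (q.bi * q.L + u % q.L) (q.bk * q.L + v % q.L) with h | ⟨_, z, _, h, hz⟩
    · rw [h]
    · rw [h]; linarith [(abs_le.1 hz).2]
  · change entryOr _ _ _ _ ≤ _
    rcases entryOr_cases hY (q.bk * q.L + u % q.L) (q.bj * q.L + v % q.L) with h | ⟨_, z, _, h, hz⟩
    · rw [h]
    · rw [h]; linarith [(abs_le.1 hz).2]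
  · rcases q.tarc_cases (u % q.L) (v % q.L) with h | ⟨_, h⟩
    · rw [h]
    · rw [h]; linarith
  · exact le_rfl

/-- Hence the query graph has `big M`-bounded weights (as a `WithTop ℤ` matrix). [folklore] -/
theorem hasBoundedWeights_qmat (hX : HasBoundedWeights q.X q.M) (hY : HasBoundedWeights q.Y q.M)
    (hlo : ∀ t, t < n * n → q.lo t + q.pw ≤ 8 * q.M + 2) :
    HasBoundedWeights (q.qmat.map ((↑) : ℤ → WithTop ℤ)) (big q.M) := fun u v =>
  Or.inr ⟨q.qmat u v, rfl, q.abs_qmat_le hX hY hlo u v⟩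

end QData

/-! ## The simultaneous binary search on the values -/

/-- **One round of binary search on a value.** If the lower bound is `T` rounded down to a
multiple of `2 pw`, then after the round (add `pw` unless the value is below `lo + pw`) it is
`T` rounded down to a multiple of `pw`. [folklore] -/
theorem lo_step {T lo pw : ℕ} (hpw : 0 < pw) (h : lo = T / (2 * pw) * (2 * pw)) :
    (lo + if T < lo + pw then 0 else pw) = T / pw * pw := by
  subst h
  have h2 : 0 < 2 * pw := by omega
  set q := T / (2 * pw) with hq
  set r := T % (2 * pw) with hr
  have hrlt : r < 2 * pw := Nat.mod_lt _ h2
  have hT : q * (2 * pw) + r = T := Nat.div_add_mod' T (2 * pw)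
  have hqq : q * (2 * pw) = 2 * q * pw := by ring
  have hT' : T = r + 2 * q * pw := by omega
  have hdiv : T / pw = r / pw + 2 * q := by rw [hT', Nat.add_mul_div_right _ _ hpw]
  by_cases hlt : r < pw
  · rw [if_pos (by omega), hdiv, Nat.div_eq_of_lt hlt, Nat.zero_add]; ring
  · have : r / pw = 1 := Nat.div_eq_of_lt_le (by omega) (by omega)
    rw [if_neg (by omega), hdiv, this]; ring

/-- The start of the binary search: below the top power of two every value rounds down to `0`. [folklore] -/
theorem lo_start {T P : ℕ} (h : T < P) : T / P * P = 0 := by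
  rw [Nat.div_eq_of_lt h, Nat.zero_mul]

/-- During the search the lower bound never exceeds `P - 2 pw` (so `lo + pw < P`). [folklore] -/
theorem lo_add_pw_lt {T P pw : ℕ} (hT : T < P) (hdvd : 2 * pw ∣ P) (hpw : 0 < pw) :
    T / (2 * pw) * (2 * pw) + pw < P := by
  obtain ⟨m, hm⟩ := hdvd
  have h1 : T / (2 * pw) * (2 * pw) ≤ T := Nat.div_mul_le_self _ _
  have h2 : T / (2 * pw) < m := by
    rw [Nat.div_lt_iff_lt_mul (by omega)]; rw [hm, Nat.mul_comm] at hT; exact hT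
  calc T / (2 * pw) * (2 * pw) + pw < (T / (2 * pw) + 1) * (2 * pw) := by nlinarith
    _ ≤ m * (2 * pw) := Nat.mul_le_mul_right _ h2
    _ = P := by rw [hm, Nat.mul_comm]

/-! ## The values searched for -/

section values

variable {n : ℕ} (X Y : Matrix (Fin n) (Fin n) (WithTop ℤ)) (M P : ℕ)

/-- The value of the pair `(i, j)` in the search: `(X ⋆ Y)ᵢⱼ + 2M ∈ [0, 4M]` if finite, `P - 1`
(above every finite value) if `⊤`. [folklore] -/
def tval (i j : Fin n) : ℕ :=
  match minPlusProduct X Y i j with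
  | ⊤ => P - 1
  | (z : ℤ) => (z + 2 * M).toNat

variable {X Y M P}

/-- `(X ⋆ Y)ᵢⱼ < t` iff some middle vertex witnesses it. [folklore] -/
theorem minPlusProduct_lt_iff (i j : Fin n) (t : ℤ) :
    minPlusProduct X Y i j < (t : WithTop ℤ) ↔
      ∃ (k : Fin n) (x y : ℤ), X i k = x ∧ Y k j = y ∧ x + y < t := by
  rw [minPlusProduct_apply, Finset.inf_lt_iff]
  constructor
  · rintro ⟨k, -, hk⟩
    cases hx : X i k with
    | top => rw [hx, top_add] at hk; exact absurd hk (not_top_lt)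
    | coe x =>
      cases hy : Y k j with
      | top => rw [hy, add_top] at hk; exact absurd hk (not_top_lt)
      | coe y =>
        rw [hx, hy, ← WithTop.coe_add, WithTop.coe_lt_coe] at hk
        exact ⟨k, x, y, hx, hy, hk⟩
  · rintro ⟨k, x, y, hx, hy, hlt⟩
    exact ⟨k, Finset.mem_univ _, by rw [hx, hy, ← WithTop.coe_add, WithTop.coe_lt_coe]; exact hlt⟩

/-- For bounded operands (`4M + 1 ≤ P - 1`) the searched value is below `lo + pw` iff some middle
vertex witnesses `X + Y + 2M < lo + pw`, provided `lo + pw ≤ P - 1`. [folklore] -/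
theorem tval_lt_iff (hX : HasBoundedWeights X M) (hY : HasBoundedWeights Y M) {i j : Fin n} {s : ℕ}
    (hs : s ≤ P - 1) :
    tval X Y M P i j < s ↔ ∃ (k : Fin n) (x y : ℤ), X i k = x ∧ Y k j = y ∧ x + y + 2 * M < s := by
  have key := minPlusProduct_lt_iff (X := X) (Y := Y) i j ((s : ℤ) - 2 * M)
  have hb := hasBoundedWeights_minPlusProduct hX hY i j
  unfold tval
  cases hZ : minPlusProduct X Y i j with
  | top =>
    simp only
    rw [hZ] at key
    constructor
    · intro h; omega
    · rintro ⟨k, x, y, hx, hy, hlt⟩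
      have := key.2 ⟨k, x, y, hx, hy, by linarith⟩
      exact absurd this (not_top_lt)
  | coe z =>
    simp only
    rw [hZ, WithTop.coe_lt_coe] at key
    rcases hb with htop | ⟨z', hz', hzM⟩
    · rw [hZ] at htop; exact absurd htop WithTop.coe_ne_top
    · rw [hZ] at hz'
      have hzz : z = z' := by exact_mod_cast hz'
      subst hzz
      have hz0 : 0 ≤ z + 2 * M := by
        have := (abs_le.1 hzM).1; push_cast at this; linarith
      have e : (((z + 2 * M).toNat : ℕ) : ℤ) = z + 2 * M := Int.toNat_of_nonneg hz0
      constructor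
      · intro h
        have h' : (((z + 2 * M).toNat : ℕ) : ℤ) < s := by exact_mod_cast h
        rw [e] at h'
        obtain ⟨k, x, y, hx, hy, hlt⟩ := key.1 (by linarith)
        exact ⟨k, x, y, hx, hy, by linarith⟩
      · rintro ⟨k, x, y, hx, hy, hlt⟩
        have := key.2 ⟨k, x, y, hx, hy, by linarith⟩
        have : (((z + 2 * M).toNat : ℕ) : ℤ) < s := by rw [e]; linarith
        exact_mod_cast this

/-- The searched values lie below `P` as soon as `4M + 2 ≤ P`. [folklore] -/
theorem tval_lt (hX : HasBoundedWeights X M) (hY : HasBoundedWeights Y M) (hP : 4 * M + 2 ≤ P)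
    (i j : Fin n) : tval X Y M P i j < P := by
  unfold tval
  cases hZ : minPlusProduct X Y i j with
  | top => simp only; omega
  | coe z =>
    simp only
    rcases hasBoundedWeights_minPlusProduct hX hY i j with htop | ⟨z', hz', hzM⟩
    · rw [hZ] at htop; exact absurd htop WithTop.coe_ne_top
    · rw [hZ] at hz'
      have hzz : z = z' := by exact_mod_cast hz'
      subst hzz
      have := (abs_le.1 hzM).2
      have h : z + 2 * M ≤ 4 * M := by push_cast at this ⊢; linarith
      have : (z + 2 * M).toNat ≤ 4 * M := by
        rw [Int.toNat_le]; exact_mod_cast h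
      omega

/-- A finite product entry has searched value `(X ⋆ Y)ᵢⱼ + 2M ≤ 4M`; an infinite one has
`P - 1`. [folklore] -/
theorem tval_cases (hX : HasBoundedWeights X M) (hY : HasBoundedWeights Y M) (i j : Fin n) :
    (minPlusProduct X Y i j = ⊤ ∧ tval X Y M P i j = P - 1) ∨
    ∃ z : ℤ, minPlusProduct X Y i j = z ∧ |z| ≤ 2 * M ∧
      (tval X Y M P i j : ℤ) = z + 2 * M := by
  unfold tval
  cases hZ : minPlusProduct X Y i j with
  | top => left; exact ⟨rfl, rfl⟩
  | coe z =>
    right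
    rcases hasBoundedWeights_minPlusProduct hX hY i j with htop | ⟨z', hz', hzM⟩
    · rw [hZ] at htop; exact absurd htop WithTop.coe_ne_top
    · rw [hZ] at hz'
      have hzz : z = z' := by exact_mod_cast hz'
      subst hzz
      refine ⟨z, rfl, by push_cast at hzM; linarith [hzM], ?_⟩
      have hz0 : 0 ≤ z + 2 * M := by
        have := (abs_le.1 hzM).1; push_cast at this; linarith
      simp only
      exact Int.toNat_of_nonneg hz0

/-- **Decoding the result of the search**: with `4M + 2 ≤ P`, the code of `(X ⋆ Y)ᵢⱼ` is `0` if the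
searched value exceeds `4M`, and otherwise the zig-zag code of `value - 2M`. [folklore] -/
theorem encode_of_tval (hX : HasBoundedWeights X M) (hY : HasBoundedWeights Y M)
    (hP : 4 * M + 2 ≤ P) (i j : Fin n) :
    encodeWithTopInt (minPlusProduct X Y i j) =
      if 4 * M < tval X Y M P i j then 0
      else if tval X Y M P i j < 2 * M then 2 * (2 * M - tval X Y M P i j)
      else 2 * (tval X Y M P i j - 2 * M) + 1 := by
  rcases tval_cases (P := P) hX hY i j with ⟨htop, ht⟩ | ⟨z, hz, hzM, ht⟩
  · rw [htop, ht, if_pos (by omega)]; rfl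
  · rw [hz]
    have hle : tval X Y M P i j ≤ 4 * M := by
      have := (abs_le.1 hzM).2
      have : (tval X Y M P i j : ℤ) ≤ 4 * M := by rw [ht]; linarith
      exact_mod_cast this
    rw [if_neg (by omega)]
    by_cases hneg : tval X Y M P i j < 2 * M
    · rw [if_pos hneg]
      -- `z < 0`: `z = -(m + 1)` with `2 (m + 1) = 2 (2M - tval)`
      have hz0 : z < 0 := by
        have : (tval X Y M P i j : ℤ) < 2 * M := by exact_mod_cast hneg
        linarith
      obtain ⟨m, rfl⟩ := Int.exists_eq_neg_ofNat hz0.le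
      cases m with
      | zero => simp at hz0
      | succ m =>
        have : (2 * M - tval X Y M P i j : ℕ) = m + 1 := by
          have h1 : ((2 * M - tval X Y M P i j : ℕ) : ℤ) = 2 * M - tval X Y M P i j := by
            push_cast [Nat.cast_sub hneg.le]; ring
          have h2 : (2 * M : ℤ) - tval X Y M P i j = m + 1 := by rw [ht]; push_cast; ring
          exact_mod_cast h1.trans h2
        rw [this, show (-((m + 1 : ℕ) : ℤ) : ℤ) = Int.negSucc m from rfl]
        simp [encodeWithTopInt, encodeInt_negSucc]; ring
    · rw [if_neg hneg]
      have hz0 : 0 ≤ z := by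
        have : (2 * M : ℤ) ≤ tval X Y M P i j := by exact_mod_cast Nat.le_of_not_lt hneg
        linarith
      obtain ⟨m, rfl⟩ := Int.eq_ofNat_of_zero_le hz0
      have : (tval X Y M P i j - 2 * M : ℕ) = m := by
        have h1 : ((tval X Y M P i j - 2 * M : ℕ) : ℤ) = tval X Y M P i j - 2 * M := by
          push_cast [Nat.cast_sub (Nat.le_of_not_lt hneg)]; ring
        have h2 : (tval X Y M P i j : ℤ) - 2 * M = m := by rw [ht]; ring
        exact_mod_cast h1.trans h2
      rw [this]
      simp [encodeWithTopInt]

end values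


end Literature.Computability.FineGrained.NegTriStep

namespace Literature.Computability.FineGrained.NegTriStep

open Cryptography Matrix

namespace QData

variable {n : ℕ} (q : QData n)

/-- Setting the row and column windows of a query. [folklore] -/
def setWin (rlo rhi clo chi : ℕ) : QData n :=
  { q with rlo := rlo, rhi := rhi, clo := clo, chi := chi }

/-- **A witness at a local pair** (column `iu`, row `iv`), the windows aside: the pair is in range
and not yet found in this round, and some middle vertex of the block `bk` gives
`X + Y + 2M < lo + pw`. [folklore] -/
def PairWit (iu iv : ℕ) : Prop :=
  ∃ (hi : q.bi * q.L + iv < n) (hj : q.bj * q.L + iu < n),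
    q.fd ((q.bi * q.L + iv) * n + (q.bj * q.L + iu)) ≠ q.pw ∧
    ∃ (kk : ℕ) (_ : kk < q.L) (hk : q.bk * q.L + kk < n) (x y : ℤ),
      q.X ⟨q.bi * q.L + iv, hi⟩ ⟨q.bk * q.L + kk, hk⟩ = x ∧
      q.Y ⟨q.bk * q.L + kk, hk⟩ ⟨q.bj * q.L + iu, hj⟩ = y ∧
      x + y + 2 * q.M < q.lo ((q.bi * q.L + iv) * n + (q.bj * q.L + iu)) + q.pw

/-- The witnesses of a query are the pair witnesses inside its windows. [folklore] -/
theorem witness_iff : q.Witness ↔ ∃ iu iv, iu < q.L ∧ iv < q.L ∧ q.rlo ≤ iv ∧ iv < q.rhi ∧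
    q.clo ≤ iu ∧ iu < q.chi ∧ q.PairWit iu iv := by
  constructor
  · rintro ⟨iu, iv, kk, hiu, hiv, hkk, hact, hk, x, y, hx, hy, hlt⟩
    exact ⟨iu, iv, hiu, hiv, hact.2.2.1, hact.2.2.2.1, hact.2.2.2.2.1, hact.2.2.2.2.2.1,
      hact.1, hact.2.1, hact.2.2.2.2.2.2, kk, hkk, hk, x, y, hx, hy, hlt⟩
  · rintro ⟨iu, iv, hiu, hiv, h1, h2, h3, h4, hi, hj, hfd, kk, hkk, hk, x, y, hx, hy, hlt⟩
    exact ⟨iu, iv, kk, hiu, hiv, hkk, ⟨hi, hj, h1, h2, h3, h4, hfd⟩, hk, x, y, hx, hy, hlt⟩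

/-- Pair witnesses do not depend on the windows. [folklore] -/
theorem pairWit_setWin (a b c d iu iv : ℕ) : (q.setWin a b c d).PairWit iu iv ↔ q.PairWit iu iv :=
  Iff.rfl

/-- The witnesses after setting the windows. [folklore] -/
theorem witness_setWin_iff (a b c d : ℕ) : (q.setWin a b c d).Witness ↔
    ∃ iu iv, iu < q.L ∧ iv < q.L ∧ a ≤ iv ∧ iv < b ∧ c ≤ iu ∧ iu < d ∧ q.PairWit iu iv :=
  (q.setWin a b c d).witness_iff

/-- Full windows: any pair witness. [folklore] -/
theorem witness_full_iff : (q.setWin 0 q.L 0 q.L).Witness ↔ ∃ iu iv, iu < q.L ∧ iv < q.L ∧ q.PairWit iu iv := by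
  rw [witness_setWin_iff]
  constructor
  · rintro ⟨iu, iv, hiu, hiv, -, -, -, -, h⟩; exact ⟨iu, iv, hiu, hiv, h⟩
  · rintro ⟨iu, iv, hiu, hiv, h⟩; exact ⟨iu, iv, hiu, hiv, Nat.zero_le _, hiv, Nat.zero_le _, hiu, h⟩

/-- A single-row window: a pair witness in that row. [folklore] -/
theorem witness_row_iff {i : ℕ} (hi : i < q.L) :
    (q.setWin i (i + 1) 0 q.L).Witness ↔ ∃ iu, iu < q.L ∧ q.PairWit iu i := by
  rw [witness_setWin_iff]
  constructor
  · rintro ⟨iu, iv, hiu, -, h1, h2, -, -, h⟩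
    obtain rfl : iv = i := by omega
    exact ⟨iu, hiu, h⟩
  · rintro ⟨iu, hiu, h⟩; exact ⟨iu, i, hiu, hi, le_rfl, Nat.lt_succ_self _, Nat.zero_le _, hiu, h⟩

/-- A single-cell window: the pair witness at that cell. [folklore] -/
theorem witness_cell_iff {i j : ℕ} (hi : i < q.L) (hj : j < q.L) :
    (q.setWin i (i + 1) j (j + 1)).Witness ↔ q.PairWit j i := by
  rw [witness_setWin_iff]
  constructor
  · rintro ⟨iu, iv, -, -, h1, h2, h3, h4, h⟩
    obtain rfl : iv = i := by omega
    obtain rfl : iu = j := by omega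
    exact h
  · intro h; exact ⟨j, i, hj, hi, le_rfl, Nat.lt_succ_self _, le_rfl, Nat.lt_succ_self _, h⟩

/-- Marking a pair found can only destroy pair witnesses. [folklore] -/
theorem PairWit.of_update {idx iu iv : ℕ} (h : ({ q with fd := Function.update q.fd idx q.pw } : QData n).PairWit iu iv) :
    q.PairWit iu iv := by
  obtain ⟨hi, hj, hfd, kk, hkk, hk, x, y, hx, hy, hlt⟩ := h
  refine ⟨hi, hj, fun h' => hfd ?_, kk, hkk, hk, x, y, hx, hy, hlt⟩
  show Function.update q.fd idx q.pw _ = q.pw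
  by_cases he : (q.bi * q.L + iv) * n + (q.bj * q.L + iu) = idx
  · rw [he, Function.update_self]
  · rw [Function.update_of_ne he]; exact h'

end QData

/-! ## Pair witnesses and the searched values -/

section link

variable {n : ℕ} {X Y : Matrix (Fin n) (Fin n) (WithTop ℤ)} {M P L : ℕ} {lo fd : ℕ → ℕ} {pw : ℕ}

/-- The query data of a block triple, with full windows. [folklore] -/
def mkQ (X Y : Matrix (Fin n) (Fin n) (WithTop ℤ)) (lo fd : ℕ → ℕ) (M pw L bi bj bk : ℕ) : QData n :=
  ⟨X, Y, lo, fd, M, pw, L, bi, bj, bk, 0, L, 0, L⟩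

/-- The number of blocks per side, `⌈n / L⌉`, exceeds `i / L` for `i < n`. [folklore] -/
theorem div_lt_blocks (hL : 1 ≤ L) {i : ℕ} (hi : i < n) : i / L < (n + L - 1) / L := by
  have : (n + L - 1) / L = (n - 1) / L + 1 := by
    rw [show n + L - 1 = (n - 1) + L by omega, Nat.add_div_right _ (by omega)]
  rw [this]
  exact Nat.lt_succ_of_le (Nat.div_le_div_right (by omega))

/-- **A pair witness bounds the searched value**: the pair is unfound and its value is below the
threshold `lo + pw`. [folklore] -/
theorem tval_lt_of_pairWit (hX : HasBoundedWeights X M) (hY : HasBoundedWeights Y M)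
    {bi bj bk iu iv : ℕ} (h : (mkQ X Y lo fd M pw L bi bj bk).PairWit iu iv) {i j : Fin n}
    (hi : bi * L + iv = i) (hj : bj * L + iu = j) (hs : lo (i * n + j) + pw ≤ P - 1) :
    fd (i * n + j) ≠ pw ∧ tval X Y M P i j < lo (i * n + j) + pw := by
  obtain ⟨hi', hj', hfd, kk, hkk, hk, x, y, hx, hy, hlt⟩ := h
  change fd ((bi * L + iv) * n + (bj * L + iu)) ≠ pw at hfd
  change bk * L + kk < n at hk
  change X ⟨bi * L + iv, hi'⟩ ⟨bk * L + kk, hk⟩ = x at hx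
  change Y ⟨bk * L + kk, hk⟩ ⟨bj * L + iu, hj'⟩ = y at hy
  change x + y + 2 * (M : ℤ) < ((lo ((bi * L + iv) * n + (bj * L + iu)) + pw : ℕ) : ℤ) at hlt
  have ei : (⟨bi * L + iv, hi'⟩ : Fin n) = i := Fin.ext hi
  have ej : (⟨bj * L + iu, hj'⟩ : Fin n) = j := Fin.ext hj
  rw [ei] at hx; rw [ej] at hy
  have eidx : (bi * L + iv) * n + (bj * L + iu) = i * n + j := by rw [hi, hj]
  rw [eidx] at hfd hlt
  exact ⟨hfd, (tval_lt_iff hX hY hs).2 ⟨⟨bk * L + kk, hk⟩, x, y, hx, hy, hlt⟩⟩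

/-- **Conversely**, an unfound pair whose value is below the threshold has a pair witness in some
middle block (at row block `i / L`, local row `i mod L`, column block `j / L`, local column
`j mod L`). [folklore] -/
theorem pairWit_of_tval_lt (hX : HasBoundedWeights X M) (hY : HasBoundedWeights Y M) (hL : 1 ≤ L)
    {i j : Fin n} (hs : lo (i * n + j) + pw ≤ P - 1) (hfd : fd (i * n + j) ≠ pw)
    (ht : tval X Y M P i j < lo (i * n + j) + pw) :
    ∃ bk, bk < (n + L - 1) / L ∧ (mkQ X Y lo fd M pw L (i / L) (j / L) bk).PairWit (j % L) (i % L) := by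
  obtain ⟨k, x, y, hx, hy, hlt⟩ := (tval_lt_iff hX hY hs).1 ht
  have hi : (i : ℕ) / L * L + i % L = i := Nat.div_add_mod' i L
  have hj : (j : ℕ) / L * L + j % L = j := Nat.div_add_mod' j L
  have hk : (k : ℕ) / L * L + k % L = k := Nat.div_add_mod' k L
  have ei : (⟨(i : ℕ) / L * L + i % L, by omega⟩ : Fin n) = i := Fin.ext hi
  have ej : (⟨(j : ℕ) / L * L + j % L, by omega⟩ : Fin n) = j := Fin.ext hj
  have ek : (⟨(k : ℕ) / L * L + k % L, by omega⟩ : Fin n) = k := Fin.ext hk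
  refine ⟨k / L, div_lt_blocks hL k.isLt, ?_⟩
  refine ⟨(show (i : ℕ) / L * L + i % L < n by omega), (show (j : ℕ) / L * L + j % L < n by omega), ?_,
    k % L, Nat.mod_lt _ (by omega), (show (k : ℕ) / L * L + k % L < n by omega), x, y, ?_, ?_, ?_⟩
  · change fd (((i : ℕ) / L * L + i % L) * n + ((j : ℕ) / L * L + j % L)) ≠ pw
    rw [hi, hj]; exact hfd
  · change X ⟨(i : ℕ) / L * L + i % L, _⟩ ⟨(k : ℕ) / L * L + k % L, _⟩ = x
    rw [ei, ek]; exact hx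
  · change Y ⟨(k : ℕ) / L * L + k % L, _⟩ ⟨(j : ℕ) / L * L + j % L, _⟩ = y
    rw [ek, ej]; exact hy
  · change x + y + 2 * (M : ℤ) < ((lo (((i : ℕ) / L * L + i % L) * n + ((j : ℕ) / L * L + j % L)) + pw : ℕ) : ℤ)
    rw [hi, hj]; exact hlt

/-- No witness for a block triple. [folklore] -/
def NoWit (X Y : Matrix (Fin n) (Fin n) (WithTop ℤ)) (lo fd : ℕ → ℕ) (M pw L bi bj bk : ℕ) : Prop :=
  ∀ iu iv, iu < L → iv < L → ¬ (mkQ X Y lo fd M pw L bi bj bk).PairWit iu iv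

/-- `NoWit` survives marking. [folklore] -/
theorem NoWit.update {bi bj bk : ℕ} (h : NoWit X Y lo fd M pw L bi bj bk) (idx : ℕ) :
    NoWit X Y lo (Function.update fd idx pw) M pw L bi bj bk := fun iu iv hiu hiv hw =>
  h iu iv hiu hiv (QData.PairWit.of_update (q := mkQ X Y lo fd M pw L bi bj bk) hw)

/-- **Completeness of a round**: once no block triple has a witness, every pair whose value is
below its threshold has been found. [folklore] -/
theorem found_of_tval_lt (hX : HasBoundedWeights X M) (hY : HasBoundedWeights Y M) (hL : 1 ≤ L)
    (hall : ∀ bi bj bk, bi < (n + L - 1) / L → bj < (n + L - 1) / L → bk < (n + L - 1) / L →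
      NoWit X Y lo fd M pw L bi bj bk)
    {i j : Fin n} (hs : lo (i * n + j) + pw ≤ P - 1) (ht : tval X Y M P i j < lo (i * n + j) + pw) :
    fd (i * n + j) = pw := by
  by_contra hfd
  obtain ⟨bk, hbk, hw⟩ := pairWit_of_tval_lt hX hY hL hs hfd ht
  exact hall _ _ bk (div_lt_blocks hL i.isLt) (div_lt_blocks hL j.isLt) hbk _ _
    (Nat.mod_lt _ (by omega)) (Nat.mod_lt _ (by omega)) hw

end link

end Literature.Computability.FineGrained.NegTriStep
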